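import Summits.HodgeConjecture.HodgeConjecture.Theorems.Ring2AbelianAllTypeIIIFourfoldsKernel
import Literature.AlgebraicGeometry.Motives.SegreHyperplaneClass
import Mathlib.Tactic.Module
import HarnessLib

/-!
# Ring 2 · AbelianAll (seat `ab-weil-2`, gen 2) — a hyperplane class compatible with a definite quaternion order always
exists (double symmetric Segre embedding); hence EVERY abelian fourfold with quaternionic multiplication by a definite
quaternion algebra carries a discriminant-1 Weil structure

HONEST FRAMING (sub-cell `pub-hodge-ring2-ab-*`, verbatim): research route, not a corollary; conditional on HC_CM plus
one named minimal statement. (Cell `pub-hodge-ring2`, verbatim: research route conditional on HC_CM; not a corollary;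
Q11.4-sentence-2 already refuted in dim ≥ 3.) THIS FILE uses neither `HC_CM` nor `B_min` and NO named fact.

WHAT IS PROVED. File 3 (`…TypeIIIFourfoldsKernel`) proved Lemma R1 for a fourfold with anticommuting `φ, ψ`
(`φ² = -d`, `ψ² = -e`) GIVEN a hyperplane class `L = ι^*a` with `φ^*L = dL`, `ψ^*L = eL` (the predicate
`HasCompatibleQuaternionPair`; for a simple type III variety every polarization qualifies — Mumford §21 Thm. 2). Here the
compatible class is CONSTRUCTED for every `(A, φ, ψ)`, so the Rosati input disappears:

* `exists_symmetrised_closedImmersion` (§1): given a closed immersion `e₀ : A ↪ ℙᴺ` and `u : A ⟶ A` with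
  `u ≫ u = -(n • 𝟙)`, `n ≥ 1`, the composite `A →(𝟙,u) A × A →(s_{n-1}e₀ × e₀) ℙ × ℙ →σ ℙᴺ'` is a closed immersion
  with hyperplane class `n·h₀ + u^*h₀` (`h₀ = e₀^*g_N`; `g` = the Segre-additive rational generators of the tree's
  `Motives.exists_segreHyperplaneClasses`, `s_d^*g = (d+1)g`) — the construction inside the tree's
  `Motives.exists_symmetricSegreEmbedding` (Markman §11.5 Step 2, Hartshorne II Ex. 5.11–5.12), isolated as a step;
* `exists_compatible_hyperplaneClass_of_anticomm` (§2): applying the step TWICE (first with `φ`, then with `ψ`) gives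
  `h₂ = e·h₁ + ψ^*h₁`, `h₁ = d·h₀ + φ^*h₀`, and `φ^*h₂ = d·h₂`, `ψ^*h₂ = e·h₂` — because `ψ^*ψ^* = e²` on `H²` and
  `φ^*ψ^* = (φψ)^* = (-(ψφ))^* = (ψφ)^* = ψ^*φ^*` on `H²` (`(-1)^* = 1` in even degree); so
  **`HasCompatibleQuaternionPair A` holds for EVERY abelian variety with anticommuting `φ, ψ` of negative integer
  squares** (`hasCompatibleQuaternionPair_of_anticomm`);
* hence (§3) **`hasDiscOneWeilStructure_of_anticomm`: every abelian FOURFOLD `A` with `φ, ψ ∈ End A`, `φ² = -d`,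
  `ψ² = -e` (`d, e ≥ 1`), `φψ = -ψφ` — i.e. with a definite quaternion order `ℤ⟨φ,ψ⟩ ⊂ End A` — carries a
  discriminant-1 Weil structure**, and `hodgeConjectureFor_powSucc_of_floccariFu_of_anticomm`: HC for all its powers
  from the Floccari–Fu fact ALONE; the cell's residual hypothesis shrinks to the pure endomorphism-algebra dichotomy
  `QuaternionFourfoldEndInput` (cell member ⟹ divisor-generated powers ∨ such `φ, ψ` exist) = Moonen–Zarhin 1999
  Thm. 0.1: a simple fourfold with non-commutative `End⁰` is case (c) (`End⁰ = D` definite quaternion: any two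
  anticommuting pure elements, scaled into `End A`) or falls under (4) (`B(Xⁿ) = D(Xⁿ)`), with
  `quaternionFourfoldAlbertInput_of_endInput` and `hodgePowersOfTypeIIIFourfold_of_floccariFu_of_endInput`.

## References

* [Hartshorne1977] R. Hartshorne, Algebraic Geometry (1977), II Ex. 5.11, Ex. 5.12 (Segre embedding, `𝒪(1)`).
* [Markman2025SurveySecant] E. Markman, arXiv:2509.23403, §11.5 Step 2 (the symmetric product embedding).
* [MumfordAV1970] D. Mumford, Abelian Varieties (1970), §6 Application 1 (projectivity), §19–§21.
* [MoonenZarhin1999LowDim] B. Moonen, Yu. Zarhin, Math. Ann. 315 (1999), Thm. 0.1, cases (c) and (4).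
* [FloccariFu2026] S. Floccari, L. Fu, J. Math. Pures Appl. 210 (2026) 103876, Thm. 1.2 (tree fact `h5`).
-/

set_option linter.dupNamespace false

noncomputable section

open CategoryTheory AlgebraicGeometry MonoidalCategory CartesianMonoidalCategory
open Literature.AlgebraicTopology.SingularHomology
open Literature.AlgebraicGeometry Literature.AlgebraicGeometry.HodgeTheory
open Literature.AlgebraicGeometry.Motives Literature.AlgebraicGeometry.Motives.SegreHyperplaneClass

namespace Summit.HodgeConjecture.HodgeConjecture.Ring2.AbelianAll

variable {A : AbelianVariety ℂ}

/-! ## §1 The symmetrisation step: `A ↪ ℙᴺ'` with hyperplane class `n·h₀ + u^*h₀` -/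

/-- **Symmetric Segre embedding along one endomorphism** (the step inside the tree's
`Motives.exists_symmetricSegreEmbedding`, isolated). Let `g` be a Segre-additive family of classes on the `ℙᴺ(ℂ)`,
`e₀ : A ↪ ℙᴺ` a closed immersion, `u : A ⟶ A` any endomorphism and `n : ℕ` a weight. Then
`(𝟙, u) ≫ (s_n e₀ × e₀) ≫ σ : A ↪ ℙᴺ'` (`N' = N_n N + N_n + N ≥ N`) is a closed immersion whose hyperplane class is
`(n+1)·e₀^*g_N + u^*e₀^*g_N`. [cite: Hartshorne1977, II Ex. 5.11 and Ex. 5.12] [cite: Markman2025SurveySecant, §11.5 Step 2] -/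
theorem exists_symmetrised_closedImmersion (g : (N : ℕ) → complexBetti (projectiveSpace N ℂ) 2)
    (hgσ : ∀ n m : ℕ, complexBetti.map (segreEmbedding n m ℂ) 2 (g (n * m + n + m)) =
      complexBetti.map (fst (projectiveSpace n ℂ) (projectiveSpace m ℂ)) 2 (g n) +
        complexBetti.map (snd (projectiveSpace n ℂ) (projectiveSpace m ℂ)) 2 (g m))
    (u : A ⟶ A) (n : ℕ) {N : ℕ} (e₀ : A.X ⟶ projectiveSpace N ℂ) (he₀ : IsClosedImmersion e₀.left) :
    ∃ (N' : ℕ) (e₁ : A.X ⟶ projectiveSpace N' ℂ), IsClosedImmersion e₁.left ∧ N ≤ N' ∧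
      complexBetti.map e₁ 2 (g N') =
        ((n + 1 : ℕ) : ℂ) • complexBetti.map e₀ 2 (g N) + complexBetti.map u.hom.hom.hom 2 (complexBetti.map e₀ 2 (g N)) := by
  haveI := he₀
  obtain ⟨ι, hι⟩ : ∃ ι : A.X ⟶ projectiveSpace (ProjectiveSpace.segrePowDim N n * N + ProjectiveSpace.segrePowDim N n + N) ℂ,
      ι = CartesianMonoidalCategory.lift (𝟙 A.X) u.hom.hom.hom ≫
        ((e₀ ≫ ProjectiveSpace.segrePow N ℂ n) ⊗ₘ e₀) ≫ segreEmbedding (ProjectiveSpace.segrePowDim N n) N ℂ :=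
    ⟨_, rfl⟩
  haveI := isClosedImmersion_segrePow_left N n
  haveI : IsClosedImmersion (e₀ ≫ ProjectiveSpace.segrePow N ℂ n).left := by
    change IsClosedImmersion (e₀.left ≫ (ProjectiveSpace.segrePow N ℂ n).left); infer_instance
  haveI := isClosedImmersion_tensorHom_left (e₀ ≫ ProjectiveSpace.segrePow N ℂ n) e₀
  haveI := isClosedImmersion_lift_id_left (X := A.X) (Y := A.X) u.hom.hom.hom
  have hιci : IsClosedImmersion ι.left := by
    rw [hι]
    change IsClosedImmersion ((CartesianMonoidalCategory.lift (𝟙 A.X) u.hom.hom.hom).left ≫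
      (((e₀ ≫ ProjectiveSpace.segrePow N ℂ n) ⊗ₘ e₀).left ≫ (segreEmbedding (ProjectiveSpace.segrePowDim N n) N ℂ).left))
    infer_instance
  refine ⟨_, ι, hιci, Nat.le_add_left _ _, ?_⟩
  rw [hι, map_comp_apply', map_comp_apply', hgσ (ProjectiveSpace.segrePowDim N n) N, map_add, map_add,
    map_tensorHom_map_fst, map_tensorHom_map_snd, map_lift_map_fst, map_lift_map_snd, complexBetti.map_id,
    ModuleCat.id_apply, map_comp_apply', map_segrePow_of_additive g hgσ N n, map_smul]

/-! ## §2 Double symmetrisation: a class compatible with both generators -/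

/-- `(-f)^* = f^*` on `H²(A(ℂ); ℂ)` (`-f = f ≫ (-(1 • 𝟙))` and `(-(1 • 𝟙))^* = 1² = 1` on `H²`).
[cite: MumfordAV1970, §19] -/
theorem complexBetti_map_neg_two (f : A ⟶ A) (y : complexBetti A.X 2) :
    complexBetti.map (-f).hom.hom.hom 2 y = complexBetti.map f.hom.hom.hom 2 y := by
  have h1 : (-f : A ⟶ A) = f ≫ (-(1 • 𝟙 A)) := by rw [one_smul, Preadditive.comp_neg, Category.comp_id]
  rw [h1, ← complexBetti_map_map_hom, complexBetti_map_neg_nsmul_id_two, Nat.cast_one, one_pow, one_smul]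

/-- `(u ≫ u)^* = n²` on `H²` for `u ≫ u = -(n • 𝟙)`, i.e. `u^*(u^*y) = n² y`. [cite: MumfordAV1970, §19] -/
theorem complexBetti_map_map_two_of_sq {n : ℕ} {u : A ⟶ A} (hu : u ≫ u = -(n • 𝟙 A)) (y : complexBetti A.X 2) :
    complexBetti.map u.hom.hom.hom 2 (complexBetti.map u.hom.hom.hom 2 y) = ((n : ℂ) ^ 2) • y := by
  rw [complexBetti_map_map_hom, hu, complexBetti_map_neg_nsmul_id_two]

variable {φ ψ : A ⟶ A} {d e : ℕ}

/-- **A hyperplane class compatible with two anticommuting generators exists.** For `φ ≫ φ = -d`, `ψ ≫ ψ = -e`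
(`d, e ≥ 1`), `φ ≫ ψ = -(ψ ≫ φ)` there are a projective embedding `ι` of `A` and a non-zero rational
`a ∈ H²(ℙᴺ(ℂ); ℂ)` with `φ^*ι^*a = d·ι^*a` and `ψ^*ι^*a = e·ι^*a`: symmetrise any embedding along `φ`
(`h₁ = d·h₀ + φ^*h₀`), then along `ψ` (`h₂ = e·h₁ + ψ^*h₁`); `φ^*h₂ = d·h₂` because `φ^*ψ^* = ψ^*φ^*` on `H²`.
[cite: Hartshorne1977, II Ex. 5.11 and Ex. 5.12] [cite: Markman2025SurveySecant, §11.5 Step 2] -/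
theorem exists_compatible_hyperplaneClass_of_anticomm (hd : 0 < d) (he : 0 < e) (hφ : φ ≫ φ = -(d • 𝟙 A))
    (hψ : ψ ≫ ψ = -(e • 𝟙 A)) (h : φ ≫ ψ = -(ψ ≫ φ)) :
    ∃ (ι : ProjectiveEmbedding A.X) (a : complexBetti (projectiveSpace ι.n ℂ) 2), IsRationalClass a ∧ a ≠ 0 ∧
      complexBetti.map φ.hom.hom.hom 2 (complexBetti.map ι.ι 2 a) = (d : ℂ) • complexBetti.map ι.ι 2 a ∧
      complexBetti.map ψ.hom.hom.hom 2 (complexBetti.map ι.ι 2 a) = (e : ℂ) • complexBetti.map ι.ι 2 a := by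
  obtain ⟨d', rfl⟩ : ∃ d', d = d' + 1 := ⟨d - 1, by omega⟩
  obtain ⟨e', rfl⟩ : ∃ e', e = e' + 1 := ⟨e - 1, by omega⟩
  obtain ⟨g, hgr, hgnz, hgσ⟩ := Motives.exists_segreHyperplaneClasses
  obtain ⟨N₀, e₀, hN₀, he₀⟩ := exists_closedImmersion_projectiveSpace_pos A
  -- step 1: symmetrise along `φ`; step 2: along `ψ`
  obtain ⟨N₁, e₁, he₁, hN₁, h₁⟩ := exists_symmetrised_closedImmersion g hgσ φ d' e₀ he₀
  obtain ⟨N₂, e₂, he₂, hN₂, h₂⟩ := exists_symmetrised_closedImmersion g hgσ ψ e' e₁ he₁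
  -- `φ^* h₁ = d h₁`
  have hφ1 : complexBetti.map φ.hom.hom.hom 2 (complexBetti.map e₁ 2 (g N₁)) =
      ((d' + 1 : ℕ) : ℂ) • complexBetti.map e₁ 2 (g N₁) := by
    rw [h₁]
    simp only [map_add, map_smul, complexBetti_map_map_two_of_sq hφ]
    module
  -- `φ^* ψ^* = ψ^* φ^*` on `H²`
  have hcomm : ∀ y : complexBetti A.X 2, complexBetti.map φ.hom.hom.hom 2 (complexBetti.map ψ.hom.hom.hom 2 y) =
      complexBetti.map ψ.hom.hom.hom 2 (complexBetti.map φ.hom.hom.hom 2 y) := fun y => by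
    rw [complexBetti_map_map_hom, complexBetti_map_map_hom, h, complexBetti_map_neg_two]
  refine ⟨⟨N₂, e₂, he₂⟩, g N₂, hgr N₂, hgnz N₂ (le_trans hN₀ (le_trans hN₁ hN₂)), ?_, ?_⟩
  · -- `φ^* h₂ = d h₂`
    change complexBetti.map φ.hom.hom.hom 2 (complexBetti.map e₂ 2 (g N₂)) = _ • complexBetti.map e₂ 2 (g N₂)
    rw [h₂]
    simp only [map_add, map_smul, hcomm, hφ1]
    module
  · -- `ψ^* h₂ = e h₂`
    change complexBetti.map ψ.hom.hom.hom 2 (complexBetti.map e₂ 2 (g N₂)) = _ • complexBetti.map e₂ 2 (g N₂)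
    rw [h₂]
    simp only [map_add, map_smul, complexBetti_map_map_two_of_sq hψ]
    module

/-- **Every abelian variety with a definite quaternion order `ℤ⟨φ, ψ⟩ ⊂ End A` carries a compatible quaternion pair**
(the Rosati-type hypothesis of file 3 is dischargeable by construction). [cite: Hartshorne1977, II Ex. 5.11 and Ex. 5.12]
[cite: MumfordAV1970, §21 Thm. 2] -/
theorem hasCompatibleQuaternionPair_of_anticomm (hd : 0 < d) (he : 0 < e) (hφ : φ ≫ φ = -(d • 𝟙 A))
    (hψ : ψ ≫ ψ = -(e • 𝟙 A)) (h : φ ≫ ψ = -(ψ ≫ φ)) : HasCompatibleQuaternionPair A := by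
  obtain ⟨ι, a, ha, ha0, hφL, hψL⟩ := exists_compatible_hyperplaneClass_of_anticomm hd he hφ hψ h
  exact ⟨φ, ψ, d, e, ι, a, hd, he, hφ, hψ, h, ha, ha0, hφL, hψL⟩

/-! ## §3 Consequences: Lemma R1 without any Rosati input; the cell modulo an `End`-algebra dichotomy -/

/-- **LEMMA R1, FINAL FORM (kernel, no named fact, no Rosati hypothesis): every complex abelian FOURFOLD with a
definite quaternion order in its endomorphism ring — `φ, ψ ∈ End A`, `φ² = -d`, `ψ² = -e` (`d, e ≥ 1`),
`φψ = -ψφ` — carries a discriminant-1 Weil structure** (`HasDiscOneWeilStructure A`: an integral pure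
`θ = aφ + bψ + cφψ` and a `θ^*`-stable rational Lagrangian 4-frame of `H¹(A(ℂ); ℂ)` for a `ℚ(θ)`-symmetrised
hyperplane class). In particular every simple abelian fourfold of type III(1), for every `(D, T)`.
[cite: vanGeemen1994HodgeAV, Lemma 5.2 and 5.4 (5.4.1)] [cite: vanGeemenVerra2003QuaternionicPryms, Lemma 4.5] -/
theorem hasDiscOneWeilStructure_of_anticomm (hA : A.dim = 4) (hd : 0 < d) (he : 0 < e)
    (hφ : φ ≫ φ = -(d • 𝟙 A)) (hψ : ψ ≫ ψ = -(e • 𝟙 A)) (h : φ ≫ ψ = -(ψ ≫ φ)) : HasDiscOneWeilStructure A :=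
  hasDiscOneWeilStructure_of_hasCompatibleQuaternionPair hA (hasCompatibleQuaternionPair_of_anticomm hd he hφ hψ h)

/-- **HC for ALL POWERS of every abelian fourfold with a definite quaternion order in `End A`, from Floccari–Fu 2026
Thm. 1.2 alone** (binder `h5`; `HC_CM` absent, no cell hypothesis, no Rosati/Albert input).
[cite: FloccariFu2026, Theorem 1.2] -/
theorem hodgeConjectureFor_powSucc_of_floccariFu_of_anticomm
    (h5 : FloccariFu2026_hodgeClasses_algebraic_powers_discOneWeilFourfold) (hA : A.dim = 4) (hd : 0 < d)
    (he : 0 < e) (hφ : φ ≫ φ = -(d • 𝟙 A)) (hψ : ψ ≫ ψ = -(e • 𝟙 A)) (h : φ ≫ ψ = -(ψ ≫ φ)) (N : ℕ) :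
    HodgeConjectureFor (A.powSucc N).dim (A.powSucc N).X :=
  hodgeConjectureFor_powSucc_of_floccariFu_of_hasDiscOneWeilStructure h5 A hA
    (hasDiscOneWeilStructure_of_anticomm hA hd he hφ hψ h) N

/-- **TYPED PRINT INPUT (hypothesis, never a fact): the endomorphism-algebra dichotomy of the cell** — Moonen–Zarhin
1999 Thm. 0.1 read for a SIMPLE fourfold with NON-COMMUTATIVE endomorphism ring: cases (a) (isogenous to
`E_k × X₂`), (b) (`End⁰` a field), (d) (`End⁰ = ℚ`) are excluded, so either case (c) — `End⁰ X = D` a DEFINITE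
quaternion algebra over `ℚ`, whence two anticommuting pure elements with negative rational squares, scaled into `End X`
— or case (4): "`Hg(X) = Sp_D(V,φ)` and `B•(Xⁿ) = D•(Xⁿ)` for all `n`". Pure endomorphism-algebra content; the Weil
structure, the hyperbolicity and the polarization are now ALL supplied by the kernel.
[cite: MoonenZarhin1999LowDim, Thm. 0.1, cases (c) and (4)] [status: typed print input; hypothesis in the kernel] -/
@[conjecture] def QuaternionFourfoldEndInput : Prop :=
  ∀ (A : AbelianVariety ℂ) (φ : A ⟶ A) (d : ℕ), 0 < d → A.dim = 4 → φ ≫ φ = -(d • 𝟙 A) →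
    (∀ c ∈ weilClassesOf A φ 2 d, IsOfHodgeType 4 A.X 4 2 2 c) →
    A.IsSimple → (∃ ψ χ : A ⟶ A, ψ ≫ χ ≠ χ ≫ ψ) →
    (∀ N : ℕ, IsDivisorGenerated (A.powSucc N)) ∨
      ∃ (φ' ψ' : A ⟶ A) (d' e' : ℕ), 0 < d' ∧ 0 < e' ∧ φ' ≫ φ' = -(d' • 𝟙 A) ∧ ψ' ≫ ψ' = -(e' • 𝟙 A) ∧
        φ' ≫ ψ' = -(ψ' ≫ φ')

/-- The `End`-algebra dichotomy implies the Albert input of file 3 (compatible pair by §2), hence gen 1's dichotomy.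
[cite: MoonenZarhin1999LowDim, Thm. 0.1, cases (c) and (4)] -/
theorem quaternionFourfoldAlbertInput_of_endInput (hE : QuaternionFourfoldEndInput) : QuaternionFourfoldAlbertInput := by
  intro A φ d hd hA hφ hW hs hnc
  rcases hE A φ d hd hA hφ hW hs hnc with hD | ⟨φ', ψ', d', e', hd', he', hφ', hψ', h'⟩
  · exact Or.inl hD
  · exact Or.inr (hasCompatibleQuaternionPair_of_anticomm hd' he' hφ' hψ' h')

/-- **CLOSING OF THE CELL, final form of this seat: Floccari–Fu (refereed named fact `h5`) + the `End`-algebra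
dichotomy of Moonen–Zarhin Thm. 0.1 (typed print input `hE`) ⟹ `Ring2.Atlas.HodgePowersOfTypeIIIFourfold`.**
`HC_CM` ABSENT; nothing cell-derived; no Rosati/polarization input. [cite: FloccariFu2026, Theorem 1.2]
[cite: MoonenZarhin1999LowDim, Thm. 0.1, cases (c) and (4)] -/
theorem hodgePowersOfTypeIIIFourfold_of_floccariFu_of_endInput
    (h5 : FloccariFu2026_hodgeClasses_algebraic_powers_discOneWeilFourfold) (hE : QuaternionFourfoldEndInput) :
    Ring2.Atlas.HodgePowersOfTypeIIIFourfold :=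
  hodgePowersOfTypeIIIFourfold_of_floccariFu_of_albertInput h5 (quaternionFourfoldAlbertInput_of_endInput hE)

/-- The same through the atlas's discriminant-1 sub-cell. [cite: FloccariFu2026, Theorem 1.2]
[cite: MoonenZarhin1999LowDim, Thm. 0.1, cases (c) and (4)] -/
theorem hodgePowersOfTypeIIIFourfold_of_discOneWeilFourfold_of_endInput
    (h : Ring2.Atlas.HodgePowersOfDiscOneWeilFourfold) (hE : QuaternionFourfoldEndInput) :
    Ring2.Atlas.HodgePowersOfTypeIIIFourfold :=
  hodgePowersOfTypeIIIFourfold_of_discOneWeilFourfold_of_albertInput h (quaternionFourfoldAlbertInput_of_endInput hE)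

end Summit.HodgeConjecture.HodgeConjecture.Ring2.AbelianAll

end
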